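import Summits.CriticalPhenomena.SAWScalingLimit.Theorems.SAWDevelopingMapNoFoldBoundAlgebra
import Literature.Probability.LatticeModels.TriangularLatticeProofs

/-!
# `NoFoldBound`, sealed ports I: the two-class algebra

Helper file for the crux `NoFoldBound` (stmt-CriticalPhenomena-8296), route `SAWDevelopingMap`,
line `Ideator3Sketch`, open stub `stub_slitCoherence` — the SEALED-PORT stratum of the interior.
At an interior vertex `v` with a sealed neighbour the first arrivals occupy two ADJACENT winding
classes (`sealed_classes`), so the Beltrami superposition of the slit source triples is
`B₁ + e^{13πi/12} B₂` against the sum superposition `S₁ + e^{5πi/12} S₂` with REAL nonnegative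
dressed port masses `B_j ≤ k S_j` (`k = k(c) < 1` the source-law constant at loop level
`c < sin(π/8)`): `|B₁ + e^{13πi/12}B₂| ≤ max B_j ≤ k max S_j ≤ k |S₁ + e^{5πi/12}S₂|`
(`cos(13π/12) ≤ -1/2`, `cos(5π/12) ≥ 0`). This file holds that finite-dimensional algebra and
two small lattice facts (a vertex of `ℍ` has a neighbour other than a given one; the three
neighbours of a vertex exhaust its neighbourhood).

## Contents (namespace `Summit.CriticalPhenomena.SAWScalingLimit.Theorems.SAWDevelopingMapNoFoldBound`)
* `dressed_le` — `β_T + √3 x Z ≤ k(c) (α_T − √3 x Z)` and `0 ≤ α_T − √3 x Z` for `0 ≤ Z ≤ c`;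
* `norm_add_mul_le_max`, `max_le_norm_add_mul`, `two_class_bound` / `helper_twoClassBound` —
  the two-class inequality;
* `re_expI_thirteen_pi_div_twelve_le`, `re_expI_five_pi_div_twelve_nonneg` — the two cosines;
* `exists_adj_ne`, `adj_cases` — neighbours in `ℍ`.
-/

noncomputable section

open scoped BigOperators
open Literature.Probability.LatticeModels Literature.Probability.RandomPlanarGeometry.SAW

namespace Summit.CriticalPhenomena.SAWScalingLimit.Theorems.SAWDevelopingMapNoFoldBound

/-! ## The dressed single-arrival bound -/

/-- **Dressed bound.** For `0 ≤ Z ≤ c < sin(π/8)`: `β_T + √3 x_c Z ≤ k (α_T − √3 x_c Z)` and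
`0 ≤ α_T − √3 x_c Z`, where `k = max(1/2, 1 − m/10)`, `m = (α_T + β_T) · 2√3 x_c (sin(π/8) − c)`
is the source-law constant of `stub_algebra_B` (the case `Y = Y' = Z` of `partB_real`).
[folklore] -/
theorem dressed_le {c Z : ℝ} (hc : c < Real.sin (Real.pi / 8)) (hZ0 : 0 ≤ Z) (hZc : Z ≤ c) :
    (1 + 2 * hexCriticalFugacity * Real.cos (11 * Real.pi / 24)) + Real.sqrt 3 * hexCriticalFugacity * Z ≤
      max (1 / 2) (1 - ((1 + 2 * hexCriticalFugacity * Real.cos (5 * Real.pi / 24)) +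
        (1 + 2 * hexCriticalFugacity * Real.cos (11 * Real.pi / 24))) *
        (2 * Real.sqrt 3 * hexCriticalFugacity * (Real.sin (Real.pi / 8) - c)) / 10) *
      ((1 + 2 * hexCriticalFugacity * Real.cos (5 * Real.pi / 24)) - Real.sqrt 3 * hexCriticalFugacity * Z) ∧
    0 ≤ (1 + 2 * hexCriticalFugacity * Real.cos (5 * Real.pi / 24)) - Real.sqrt 3 * hexCriticalFugacity * Z := by
  set x := hexCriticalFugacity with hx
  set α := 1 + 2 * x * Real.cos (5 * Real.pi / 24) with hα
  set β := 1 + 2 * x * Real.cos (11 * Real.pi / 24) with hβ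
  have x0 : 0 < x := nfb_xc_pos
  have x55 : x < 0.55 := xc_lt
  have s39 : Real.sin (Real.pi / 8) < 0.394 := sin_pi_div_eight_lt
  have r3 : Real.sqrt 3 < 1.7321 := sqrt_three_lt
  have r30 : 0 < Real.sqrt 3 := by positivity
  have hβ0 : 0 ≤ β := nfb_betaT_nonneg
  have hc0 : 0 ≤ c := hZ0.trans hZc
  have hcos0 : 0 ≤ Real.cos (5 * Real.pi / 24) :=
    Real.cos_nonneg_of_mem_Icc ⟨by linarith [Real.pi_pos], by linarith [Real.pi_pos]⟩
  have hα1 : 1 ≤ α := by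
    have : 0 ≤ 2 * x * Real.cos (5 * Real.pi / 24) := by positivity
    linarith
  -- `√3 x Z ≤ √3 x c < 0.38`
  have hxZ : x * Z ≤ 0.55 * 0.394 := by
    have h1 : x * Z ≤ x * c := mul_le_mul_of_nonneg_left hZc x0.le
    have h2 : x * c ≤ 0.55 * c := mul_le_mul_of_nonneg_right x55.le hc0
    nlinarith
  have hxZ0 : 0 ≤ x * Z := mul_nonneg x0.le hZ0
  have h3 : Real.sqrt 3 * (x * Z) ≤ 1.7321 * (0.55 * 0.394) :=
    mul_le_mul r3.le hxZ hxZ0 (by norm_num)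
  have hS0 : 0 ≤ α - Real.sqrt 3 * x * Z := by nlinarith
  refine ⟨?_, hS0⟩
  have hL0 : 0 ≤ β + Real.sqrt 3 * x * Z := by positivity
  have h := (partB_real hc hZ0 hZc hZ0 hZc hS0 hL0 (L := β + Real.sqrt 3 * x * Z)
    (m := (α + β) * (2 * Real.sqrt 3 * x * (Real.sin (Real.pi / 8) - c)))
    (k := max (1 / 2) (1 - (α + β) * (2 * Real.sqrt 3 * x * (Real.sin (Real.pi / 8) - c)) / 10))
    (by rw [hα]; ring) (by rw [hβ]; ring) rfl rfl).1
  exact h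

/-! ## The two-class inequality -/

/-- For `b₁, b₂ ≥ 0` and `P` with `|P| ≤ 1`, `Re P ≤ -1/2`: `|b₁ + P b₂| ≤ max(b₁, b₂)`
(`|b₁ + Pb₂|² ≤ b₁² - b₁b₂ + b₂² ≤ max²`). [folklore] -/
theorem norm_add_mul_le_max {b₁ b₂ : ℝ} {P : ℂ} (hb₁ : 0 ≤ b₁) (hb₂ : 0 ≤ b₂) (hP : ‖P‖ ≤ 1)
    (hre : P.re ≤ -(1 / 2)) : ‖(b₁ : ℂ) + P * b₂‖ ≤ max b₁ b₂ := by
  have hm0 : 0 ≤ max b₁ b₂ := le_max_of_le_left hb₁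
  rw [← sq_le_sq₀ (norm_nonneg _) hm0, Complex.sq_norm, Complex.normSq_apply]
  simp only [Complex.add_re, Complex.add_im, Complex.mul_re, Complex.mul_im, Complex.ofReal_re,
    Complex.ofReal_im, mul_zero, sub_zero, zero_add]
  have hP2 : P.re * P.re + P.im * P.im ≤ 1 := by
    have h := hP
    rw [← sq_le_one_iff₀ (norm_nonneg P), Complex.sq_norm, Complex.normSq_apply] at h
    exact h
  have key : (b₁ + P.re * b₂) * (b₁ + P.re * b₂) + P.im * b₂ * (P.im * b₂) ≤
      b₁ ^ 2 - b₁ * b₂ + b₂ ^ 2 := by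
    have e : (b₁ + P.re * b₂) * (b₁ + P.re * b₂) + P.im * b₂ * (P.im * b₂) =
        b₁ ^ 2 + 2 * P.re * (b₁ * b₂) + (P.re * P.re + P.im * P.im) * b₂ ^ 2 := by ring
    rw [e]
    have h1 : 2 * P.re * (b₁ * b₂) ≤ -(b₁ * b₂) := by nlinarith [mul_nonneg hb₁ hb₂]
    have h2 : (P.re * P.re + P.im * P.im) * b₂ ^ 2 ≤ 1 * b₂ ^ 2 :=
      mul_le_mul_of_nonneg_right hP2 (sq_nonneg _)
    linarith
  refine key.trans ?_
  rcases le_total b₁ b₂ with h | h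
  · rw [max_eq_right h]; nlinarith
  · rw [max_eq_left h]; nlinarith

/-- For `s₁, s₂ ≥ 0` and `Q` with `|Q| = 1`, `Re Q ≥ 0`: `max(s₁, s₂) ≤ |s₁ + Q s₂|`. [folklore] -/
theorem max_le_norm_add_mul {s₁ s₂ : ℝ} {Q : ℂ} (hs₁ : 0 ≤ s₁) (hs₂ : 0 ≤ s₂) (hQ : ‖Q‖ = 1)
    (hre : 0 ≤ Q.re) : max s₁ s₂ ≤ ‖(s₁ : ℂ) + Q * s₂‖ := by
  have hm0 : 0 ≤ max s₁ s₂ := le_max_of_le_left hs₁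
  rw [← sq_le_sq₀ hm0 (norm_nonneg _), Complex.sq_norm, Complex.normSq_apply]
  simp only [Complex.add_re, Complex.add_im, Complex.mul_re, Complex.mul_im, Complex.ofReal_re,
    Complex.ofReal_im, mul_zero, sub_zero, zero_add]
  have hQ2 : Q.re * Q.re + Q.im * Q.im = 1 := by
    have h : Complex.normSq Q = 1 := by rw [Complex.normSq_eq_norm_sq, hQ, one_pow]
    rw [Complex.normSq_apply] at h
    exact h
  have key : s₁ ^ 2 + s₂ ^ 2 ≤
      (s₁ + Q.re * s₂) * (s₁ + Q.re * s₂) + Q.im * s₂ * (Q.im * s₂) := by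
    have e : (s₁ + Q.re * s₂) * (s₁ + Q.re * s₂) + Q.im * s₂ * (Q.im * s₂) =
        s₁ ^ 2 + 2 * Q.re * (s₁ * s₂) + (Q.re * Q.re + Q.im * Q.im) * s₂ ^ 2 := by ring
    rw [e, hQ2]
    nlinarith [mul_nonneg hs₁ hs₂]
  refine le_trans ?_ key
  rcases le_total s₁ s₂ with h | h
  · rw [max_eq_right h]; nlinarith
  · rw [max_eq_left h]; nlinarith

/-- **The two-class bound.** If `0 ≤ b_j ≤ k s_j` (`j = 1, 2`, `k ≥ 0`), `|P| ≤ 1`, `Re P ≤ -1/2`,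
`|Q| = 1`, `Re Q ≥ 0`, `s_j ≥ 0`, then `|b₁ + P b₂| ≤ k |s₁ + Q s₂|`. [folklore] -/
theorem two_class_bound {b₁ b₂ s₁ s₂ k : ℝ} {P Q : ℂ} (hb₁ : 0 ≤ b₁) (hb₂ : 0 ≤ b₂)
    (hs₁ : 0 ≤ s₁) (hs₂ : 0 ≤ s₂) (hk : 0 ≤ k) (h₁ : b₁ ≤ k * s₁) (h₂ : b₂ ≤ k * s₂)
    (hP : ‖P‖ ≤ 1) (hPre : P.re ≤ -(1 / 2)) (hQ : ‖Q‖ = 1) (hQre : 0 ≤ Q.re) :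
    ‖(b₁ : ℂ) + P * b₂‖ ≤ k * ‖(s₁ : ℂ) + Q * s₂‖ := by
  calc ‖(b₁ : ℂ) + P * b₂‖ ≤ max b₁ b₂ := norm_add_mul_le_max hb₁ hb₂ hP hPre
    _ ≤ k * max s₁ s₂ := by
        rcases le_total b₁ b₂ with h | h
        · rw [max_eq_right h]
          exact h₂.trans (mul_le_mul_of_nonneg_left (le_max_right _ _) hk)
        · rw [max_eq_left h]
          exact h₁.trans (mul_le_mul_of_nonneg_left (le_max_left _ _) hk)
    _ ≤ k * ‖(s₁ : ℂ) + Q * s₂‖ :=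
        mul_le_mul_of_nonneg_left (max_le_norm_add_mul hs₁ hs₂ hQ hQre) hk

/-- **Helper (registered form of `two_class_bound`).** [folklore] -/
theorem helper_twoClassBound :
    ∀ (b₁ b₂ s₁ s₂ k : ℝ) (P Q : ℂ), 0 ≤ b₁ → 0 ≤ b₂ → 0 ≤ s₁ → 0 ≤ s₂ → 0 ≤ k →
      b₁ ≤ k * s₁ → b₂ ≤ k * s₂ → ‖P‖ ≤ 1 → P.re ≤ -(1 / 2) → ‖Q‖ = 1 → 0 ≤ Q.re →
      ‖(b₁ : ℂ) + P * b₂‖ ≤ k * ‖(s₁ : ℂ) + Q * s₂‖ :=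
  fun _ _ _ _ _ _ _ hb₁ hb₂ hs₁ hs₂ hk h₁ h₂ hP hPre hQ hQre =>
    two_class_bound hb₁ hb₂ hs₁ hs₂ hk h₁ h₂ hP hPre hQ hQre

/-! ## The two phases -/

/-- `Re e^{13πi/12} = -cos(π/12) ≤ -1/2`. [folklore] -/
theorem re_expI_thirteen_pi_div_twelve_le :
    (Complex.exp ((13 * Real.pi / 12 : ℝ) * Complex.I)).re ≤ -(1 / 2) := by
  rw [Complex.exp_ofReal_mul_I_re, show 13 * Real.pi / 12 = Real.pi / 12 + Real.pi by ring,
    Real.cos_add_pi]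
  have h : Real.cos (Real.pi / 3) ≤ Real.cos (Real.pi / 12) :=
    Real.cos_le_cos_of_nonneg_of_le_pi (by linarith [Real.pi_pos]) (by linarith [Real.pi_pos])
      (by linarith [Real.pi_pos])
  rw [Real.cos_pi_div_three] at h
  linarith

/-- `Re e^{5πi/12} = cos(5π/12) ≥ 0`. [folklore] -/
theorem re_expI_five_pi_div_twelve_nonneg :
    0 ≤ (Complex.exp ((5 * Real.pi / 12 : ℝ) * Complex.I)).re := by
  rw [Complex.exp_ofReal_mul_I_re]
  exact Real.cos_nonneg_of_mem_Icc ⟨by linarith [Real.pi_pos], by linarith [Real.pi_pos]⟩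

/-- `ω · e^{iσ·2π/3} = e^{13πi/12}` (`ω = e^{2πi/3}`, `σ = 5/8`). [folklore] -/
theorem omega_mul_exp_sigma :
    Complex.exp (2 * Real.pi * Complex.I / 3) *
      Complex.exp (Complex.I * (5 / 8 : ℝ) * ((2 * Real.pi / 3 : ℝ) : ℂ)) =
      Complex.exp ((13 * Real.pi / 12 : ℝ) * Complex.I) := by
  rw [← Complex.exp_add]
  congr 1
  push_cast
  ring

/-- `e^{iσ·2π/3} = e^{5πi/12}` (`σ = 5/8`). [folklore] -/
theorem exp_sigma_eq :
    Complex.exp (Complex.I * (5 / 8 : ℝ) * ((2 * Real.pi / 3 : ℝ) : ℂ)) =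
      Complex.exp ((5 * Real.pi / 12 : ℝ) * Complex.I) := by
  congr 1
  push_cast
  ring

/-! ## Neighbours in the hexagonal lattice -/

/-- Every vertex of `ℍ` has a neighbour other than a given vertex (it has three). [folklore] -/
theorem exists_adj_ne (w v : HexVertex) : ∃ y : HexVertex, hexGraph.Adj w y ∧ y ≠ v := by
  have h3 := card_neighborSet_hexGraph_holds w
  obtain ⟨p, q, r, hpq, -, -, hS⟩ := Set.ncard_eq_three.1 h3
  have hp : hexGraph.Adj w p := by
    rw [← SimpleGraph.mem_neighborSet, hS]; simp
  have hq : hexGraph.Adj w q := by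
    rw [← SimpleGraph.mem_neighborSet, hS]; simp
  by_cases hpv : p = v
  · exact ⟨q, hq, fun h => hpq (hpv.trans h.symm)⟩
  · exact ⟨p, hp, hpv⟩

/-- The three pairwise distinct neighbours of a vertex of `ℍ` are all its neighbours. [folklore] -/
theorem adj_cases {v w₀ w₁ w₂ y : HexVertex} (h₀ : hexGraph.Adj v w₀) (h₁ : hexGraph.Adj v w₁)
    (h₂ : hexGraph.Adj v w₂) (h₀₁ : w₀ ≠ w₁) (h₁₂ : w₁ ≠ w₂) (h₀₂ : w₀ ≠ w₂)
    (hy : hexGraph.Adj v y) : y = w₀ ∨ y = w₁ ∨ y = w₂ := by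
  classical
  have h3 := card_neighborSet_hexGraph_holds v
  have hfin : (hexGraph.neighborSet v).Finite := Set.finite_of_ncard_pos (by rw [h3]; norm_num)
  have hsub : ({w₀, w₁, w₂} : Set HexVertex) ⊆ hexGraph.neighborSet v := by
    intro z hz
    simp only [Set.mem_insert_iff, Set.mem_singleton_iff] at hz
    rcases hz with rfl | rfl | rfl
    · exact h₀
    · exact h₁
    · exact h₂
  have hcard : (hexGraph.neighborSet v).ncard ≤ ({w₀, w₁, w₂} : Set HexVertex).ncard := by
    rw [h3, Set.ncard_eq_toFinset_card' {w₀, w₁, w₂}]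
    simp [h₀₁, h₁₂, h₀₂]
  have heq := Set.eq_of_subset_of_ncard_le hsub hcard hfin
  have hy' : y ∈ ({w₀, w₁, w₂} : Set HexVertex) := by rw [heq]; exact hy
  simpa only [Set.mem_insert_iff, Set.mem_singleton_iff] using hy'

end Summit.CriticalPhenomena.SAWScalingLimit.Theorems.SAWDevelopingMapNoFoldBound

end
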